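import Mathlib
import Summits.Ventures.PercRepro2.Defs
import Summits.Ventures.PercRepro2.Independence
import Summits.Ventures.PercRepro2.Harris
import Summits.Ventures.PercRepro2.Graph
import Summits.Ventures.PercRepro2.Events
import Summits.Ventures.PercRepro2.RootCutSupport
import Summits.Ventures.PercRepro2.CutSepDefs

/-!
# The weighted (PM) per-side brackets across a cut vertex, mixed placement (blind cell PercRepro2,
mine-2 g20; proofs/MINE2-CUTU.md §7 Theorem 6 case (3), M2-42 addendum)

The host `u` is a cut vertex separating the roots: the graph splits into a side `VL ∋ a₁, o` and a side
`VH ∋ a₂, b` meeting only in `u` (`CutSep`, `CutSepDefs.lean`).  Every connection is read off the two side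
restrictions (`conn_side` / `conn_cross` of `RootCutSupport.lean`), the side events are independent (disjoint edge
sets), and both per-side brackets of the weighted (PM) (`Q = {a₁ ↮ a₂}`, multiplied out by `P(Q)³`, the same cleared
forms as in `LeafRootPM.lean` / `LeafRootPMH.lean`) are PRODUCTS of nonnegative side masses:

  `P(Q)³ · (HALF-PM⁺)_L = β · t_u · ȳ_b · [(1 − β) C_ou + β (1 − t_u) x_o]`,
  `P(Q)³ · (HALF-PM⁺)_H = t_u · Cov_VH(B, Z_b) · [(1 − β) C_ou + β (1 − t_u) x_o]`,

with `A = {a₁ ↔ u in VL}`, `t_u = P(A)`, `C_ou = P(L_o A) − P(A) P(L_o) ≥ 0` (Harris), `x_o = P({u ↔ o in VL} Aᶜ)`,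
`B = {u ↔ a₂ in VH}`, `β = P(B)`, `ȳ_b = P({u ↔ b in VH} Bᶜ)`, `Cov_VH(B, Z_b) = P(Z_b B) − P(Z_b) P(B) ≥ 0`
(Harris; `Z_b = {a₂ ↔ b in VH}`).  Theorems `halfL_mixed_nonneg`, `halfH_mixed_nonneg`.  Together with the leaf
class (both marks on one side) and the mirrors under `a₁ ↔ a₂`, this is the per-side content of Theorem 6:
the weighted (PM) holds whenever the host is an unmarked cut vertex separating the roots (the step to `β₁`
itself is paper).  Typed version: not claimed.
-/

namespace Summit.Ventures.PercRepro2

namespace CutMixedPM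

open CovForm.RootBridge

section MainL

variable {V : Type*} {E : Type*} [Fintype E] [DecidableEq E]
  {R : Type*} [CommRing R] [LinearOrder R] [IsStrictOrderedRing R]

/-- **The L-half of the weighted (PM) is nonnegative in the mixed cut-vertex placement** (`o` on `a₁`'s
side, `b` on `a₂`'s side): the cleared form `P(Q)·[P(Q) P(L_b H_u oU Q) − P(L_b Q) P(H_u oU Q)]
− P(oU Q)·[P(Q) P(L_b H_u Q) − P(L_b Q) P(H_u Q)] − P(Q)·[P(Q) P(L_b H_o Q) − P(L_b Q) P(H_o Q)]`
equals `β t_u ȳ_b [(1 − β) C_ou + β (1 − t_u) x_o] ≥ 0`. -/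
theorem halfL_mixed_nonneg (p : E → R) (hp : IsProbVec p) (ends : E → Sym2 V) (o a₁ a₂ b u : V)
    {VL VH : Set V} (hc : CutSep ends a₁ o a₂ b u VL VH) :
    0 ≤ prob p (connEvent ends a₁ a₂)ᶜ *
          (prob p (connEvent ends a₁ a₂)ᶜ *
              prob p (connEvent ends a₁ b ∩ connEvent ends a₂ u ∩
                (connEvent ends a₁ o ∪ connEvent ends a₂ o) ∩ (connEvent ends a₁ a₂)ᶜ) -
            prob p (connEvent ends a₁ b ∩ (connEvent ends a₁ a₂)ᶜ) *
              prob p (connEvent ends a₂ u ∩ (connEvent ends a₁ o ∪ connEvent ends a₂ o) ∩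
                (connEvent ends a₁ a₂)ᶜ)) -
        prob p ((connEvent ends a₁ o ∪ connEvent ends a₂ o) ∩ (connEvent ends a₁ a₂)ᶜ) *
          (prob p (connEvent ends a₁ a₂)ᶜ *
              prob p (connEvent ends a₁ b ∩ connEvent ends a₂ u ∩ (connEvent ends a₁ a₂)ᶜ) -
            prob p (connEvent ends a₁ b ∩ (connEvent ends a₁ a₂)ᶜ) *
              prob p (connEvent ends a₂ u ∩ (connEvent ends a₁ a₂)ᶜ)) -
        prob p (connEvent ends a₁ a₂)ᶜ *
          (prob p (connEvent ends a₁ a₂)ᶜ *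
              prob p (connEvent ends a₁ b ∩ connEvent ends a₂ o ∩ (connEvent ends a₁ a₂)ᶜ) -
            prob p (connEvent ends a₁ b ∩ (connEvent ends a₁ a₂)ᶜ) *
              prob p (connEvent ends a₂ o ∩ (connEvent ends a₁ a₂)ᶜ)) := by
  -- the dictionary of events
  have hQ : connEvent ends a₁ a₂ = CW ends VL a₁ u ∩ CW ends VH u a₂ :=
    connEvent_eq_cross_LH hc hc.a1L hc.a2H hc.a2u
  have hLb : connEvent ends a₁ b = CW ends VL a₁ u ∩ CW ends VH u b :=
    connEvent_eq_cross_LH hc hc.a1L hc.bH hc.bu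
  have hHu : connEvent ends a₂ u = CW ends VH u a₂ := by
    rw [connEvent_eq_CW_H hc hc.a2H hc.uH, CW_comm]
  have hLo : connEvent ends a₁ o = CW ends VL a₁ o := connEvent_eq_CW_L hc hc.a1L hc.oL
  have hHo : connEvent ends a₂ o = CW ends VH u a₂ ∩ CW ends VL u o := by
    rw [connEvent_eq_cross_HL hc hc.a2H hc.oL hc.ou, CW_comm (ends := ends) a₂ u]
  rw [hQ, hLb, hHu, hLo, hHo]
  set A := CW ends VL a₁ u with hA
  set B := CW ends VH u a₂ with hB
  set Yb := CW ends VH u b with hYb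
  set Lo := CW ends VL a₁ o with hLo'
  set Xo := CW ends VL u o with hXo
  have hdis := disjoint_within hc
  have dA : DependsOn (· ∈ A) (within ends VL) := dependsOn_CW a₁ u
  have dLo : DependsOn (· ∈ Lo) (within ends VL) := dependsOn_CW a₁ o
  have dXo : DependsOn (· ∈ Xo) (within ends VL) := dependsOn_CW u o
  have dB : DependsOn (· ∈ B) (within ends VH) := dependsOn_CW u a₂
  have dYb : DependsOn (· ∈ Yb) (within ends VH) := dependsOn_CW u b
  have dAc : DependsOn (· ∈ Aᶜ) (within ends VL) := dependsOn_compl dA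
  have dBc : DependsOn (· ∈ Bᶜ) (within ends VH) := dependsOn_compl dB
  -- `{a₁ ↔ o} ∩ {u ↔ o} ⊆ {a₁ ↔ u}` inside `VL`
  have hLoXo : Lo ∩ Xo ⊆ A := CW_inter_subset a₁ o u
  have hdisj1 : Disjoint (Lo ∩ (A ∩ B)ᶜ) ((Xo ∩ Aᶜ) ∩ B) := by
    rw [Set.disjoint_left]
    rintro ω ⟨hLo', _⟩ ⟨⟨hXo', hA'⟩, _⟩
    exact hA' (hLoXo ⟨hLo', hXo'⟩)
  have hdisj2 : Disjoint (Lo ∩ Aᶜ) (Xo ∩ Aᶜ) := by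
    rw [Set.disjoint_left]
    rintro ω ⟨hLo', hA'⟩ ⟨hXo', _⟩
    exact hA' (hLoXo ⟨hLo', hXo'⟩)
  -- independence across the cut vertex
  have ind : ∀ {X Y : Set (Config E)}, DependsOn (· ∈ X) (within ends VL) →
      DependsOn (· ∈ Y) (within ends VH) → prob p (X ∩ Y) = prob p X * prob p Y :=
    fun hX hY => prob_inter_eq_mul_of_dependsOn p hdis hX hY
  have hAc : prob p Aᶜ = 1 - prob p A := prob_compl p A
  have hsplit_o : prob p (Lo ∩ A) + prob p (Lo ∩ Aᶜ) = prob p Lo :=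
    prob_inter_add_prob_inter_compl p Lo A
  -- the nine probabilities
  have d0 : prob p (A ∩ B)ᶜ = 1 - prob p A * prob p B := by rw [prob_compl, ind dA dB]
  have d1 : prob p (A ∩ Yb ∩ (A ∩ B)ᶜ) = prob p A * prob p (Yb ∩ Bᶜ) := by
    rw [set_m2, ind dA (depI dYb dBc)]
  have d2 : prob p (B ∩ (A ∩ B)ᶜ) = (1 - prob p A) * prob p B := by
    rw [set_m3, ind dAc dB, hAc]
  have d3 : prob p (A ∩ Yb ∩ B ∩ (A ∩ B)ᶜ) = 0 := by rw [set_m4, prob_empty]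
  have d4 : prob p (Lo ∩ (A ∩ B)ᶜ) = prob p Lo - prob p (Lo ∩ A) * prob p B := by
    have := prob_inter_add_prob_inter_compl p Lo (A ∩ B)
    rw [set_m5', ind (depI dLo dA) dB] at this
    linarith
  have d5 : prob p ((Lo ∪ B ∩ Xo) ∩ (A ∩ B)ᶜ) =
      (prob p Lo - prob p (Lo ∩ A) * prob p B) + prob p (Xo ∩ Aᶜ) * prob p B := by
    rw [set_m5, prob_union_of_disjoint p hdisj1, d4, ind (depI dXo dAc) dB]
  have d6 : prob p (B ∩ (Lo ∪ B ∩ Xo) ∩ (A ∩ B)ᶜ) =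
      (prob p (Lo ∩ Aᶜ) + prob p (Xo ∩ Aᶜ)) * prob p B := by
    rw [set_m6, ind (depI (depU dLo dXo) dAc) dB, set_m6', prob_union_of_disjoint p hdisj2]
  have d7 : prob p (A ∩ Yb ∩ B ∩ (Lo ∪ B ∩ Xo) ∩ (A ∩ B)ᶜ) = 0 := by rw [set_m7, prob_empty]
  have d8 : prob p (B ∩ Xo ∩ (A ∩ B)ᶜ) = prob p (Xo ∩ Aᶜ) * prob p B := by
    rw [set_m8, ind (depI dXo dAc) dB]
  have d9 : prob p (A ∩ Yb ∩ (B ∩ Xo) ∩ (A ∩ B)ᶜ) = 0 := by rw [set_m9, prob_empty]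
  rw [d0, d1, d2, d3, d5, d6, d7, d8, d9]
  clear d0 d1 d2 d3 d4 d5 d6 d7 d8 d9 hdisj1 hdisj2
  -- Harris inside `VL`, nonnegativity
  have hHarris_o := prob_mul_prob_le_prob_inter hp (isUpperSet_CW (ends := ends) (W := VL) a₁ o)
    (isUpperSet_CW (ends := ends) (W := VL) a₁ u)
  have hβ0 := prob_nonneg hp B
  have hβ1 := prob_le_one hp B
  have htu0 := prob_nonneg hp A
  have htu1 := prob_le_one hp A
  have hyb := prob_nonneg hp (Yb ∩ Bᶜ)
  have hxo := prob_nonneg hp (Xo ∩ Aᶜ)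
  rw [← hsplit_o]
  rw [← hsplit_o] at hHarris_o
  clear hsplit_o dA dLo dXo dB dYb dAc dBc hLoXo ind hAc
  generalize prob p B = β at *
  generalize prob p A = tu at *
  generalize prob p (Lo ∩ A) = kou at *
  generalize prob p (Lo ∩ Aᶜ) = mo at *
  generalize prob p (Xo ∩ Aᶜ) = xo at *
  generalize prob p (Yb ∩ Bᶜ) = yb at *
  have hCo : 0 ≤ kou - tu * (kou + mo) := by linarith only [hHarris_o]
  have key : (1 - tu * β) * ((1 - tu * β) * 0 - tu * yb * ((mo + xo) * β)) -
        (kou + mo - kou * β + xo * β) * ((1 - tu * β) * 0 - tu * yb * ((1 - tu) * β)) -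
        (1 - tu * β) * ((1 - tu * β) * 0 - tu * yb * (xo * β)) =
      β * tu * yb * ((1 - β) * (kou - tu * (kou + mo)) + β * (1 - tu) * xo) := by ring
  rw [key]
  apply mul_nonneg (mul_nonneg (mul_nonneg hβ0 htu0) hyb)
  exact add_nonneg (mul_nonneg (by linarith only [hβ1]) hCo)
    (mul_nonneg (mul_nonneg hβ0 (by linarith only [htu1])) hxo)


/-- **The H-half of the weighted (PM) is nonnegative in the mixed cut-vertex placement**: the cleared form
`P(Q)·[P(Q) P(H_b L_u oU Q) − P(H_b Q) P(L_u oU Q)] − P(oU Q)·[P(Q) P(H_b L_u Q) − P(H_b Q) P(L_u Q)]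
− P(Q)·[P(Q) P(H_b L_o Q) − P(H_b Q) P(L_o Q)]` equals `t_u · Cov_VH(B, Z_b) · [(1 − β) C_ou + β (1 − t_u) x_o] ≥ 0`. -/
theorem halfH_mixed_nonneg (p : E → R) (hp : IsProbVec p) (ends : E → Sym2 V) (o a₁ a₂ b u : V)
    {VL VH : Set V} (hc : CutSep ends a₁ o a₂ b u VL VH) :
    0 ≤ prob p (connEvent ends a₁ a₂)ᶜ *
          (prob p (connEvent ends a₁ a₂)ᶜ *
              prob p (connEvent ends a₂ b ∩ connEvent ends a₁ u ∩
                (connEvent ends a₁ o ∪ connEvent ends a₂ o) ∩ (connEvent ends a₁ a₂)ᶜ) -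
            prob p (connEvent ends a₂ b ∩ (connEvent ends a₁ a₂)ᶜ) *
              prob p (connEvent ends a₁ u ∩ (connEvent ends a₁ o ∪ connEvent ends a₂ o) ∩
                (connEvent ends a₁ a₂)ᶜ)) -
        prob p ((connEvent ends a₁ o ∪ connEvent ends a₂ o) ∩ (connEvent ends a₁ a₂)ᶜ) *
          (prob p (connEvent ends a₁ a₂)ᶜ *
              prob p (connEvent ends a₂ b ∩ connEvent ends a₁ u ∩ (connEvent ends a₁ a₂)ᶜ) -
            prob p (connEvent ends a₂ b ∩ (connEvent ends a₁ a₂)ᶜ) *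
              prob p (connEvent ends a₁ u ∩ (connEvent ends a₁ a₂)ᶜ)) -
        prob p (connEvent ends a₁ a₂)ᶜ *
          (prob p (connEvent ends a₁ a₂)ᶜ *
              prob p (connEvent ends a₂ b ∩ connEvent ends a₁ o ∩ (connEvent ends a₁ a₂)ᶜ) -
            prob p (connEvent ends a₂ b ∩ (connEvent ends a₁ a₂)ᶜ) *
              prob p (connEvent ends a₁ o ∩ (connEvent ends a₁ a₂)ᶜ)) := by
  have hQ : connEvent ends a₁ a₂ = CW ends VL a₁ u ∩ CW ends VH u a₂ :=
    connEvent_eq_cross_LH hc hc.a1L hc.a2H hc.a2u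
  have hHb : connEvent ends a₂ b = CW ends VH a₂ b := connEvent_eq_CW_H hc hc.a2H hc.bH
  have hLu : connEvent ends a₁ u = CW ends VL a₁ u := connEvent_eq_CW_L hc hc.a1L hc.uL
  have hLo : connEvent ends a₁ o = CW ends VL a₁ o := connEvent_eq_CW_L hc hc.a1L hc.oL
  have hHo : connEvent ends a₂ o = CW ends VH u a₂ ∩ CW ends VL u o := by
    rw [connEvent_eq_cross_HL hc hc.a2H hc.oL hc.ou, CW_comm (ends := ends) a₂ u]
  rw [hQ, hHb, hLu, hLo, hHo]
  set A := CW ends VL a₁ u with hA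
  set B := CW ends VH u a₂ with hB
  set Zb := CW ends VH a₂ b with hZb
  set Lo := CW ends VL a₁ o with hLo'
  set Xo := CW ends VL u o with hXo
  have hdis := disjoint_within hc
  have dA : DependsOn (· ∈ A) (within ends VL) := dependsOn_CW a₁ u
  have dLo : DependsOn (· ∈ Lo) (within ends VL) := dependsOn_CW a₁ o
  have dXo : DependsOn (· ∈ Xo) (within ends VL) := dependsOn_CW u o
  have dB : DependsOn (· ∈ B) (within ends VH) := dependsOn_CW u a₂
  have dZb : DependsOn (· ∈ Zb) (within ends VH) := dependsOn_CW a₂ b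
  have dAc : DependsOn (· ∈ Aᶜ) (within ends VL) := dependsOn_compl dA
  have dBc : DependsOn (· ∈ Bᶜ) (within ends VH) := dependsOn_compl dB
  have hLoXo : Lo ∩ Xo ⊆ A := CW_inter_subset a₁ o u
  have hdisj1 : Disjoint (Lo ∩ (A ∩ B)ᶜ) ((Xo ∩ Aᶜ) ∩ B) := by
    rw [Set.disjoint_left]
    rintro ω ⟨hLo', _⟩ ⟨⟨hXo', hA'⟩, _⟩
    exact hA' (hLoXo ⟨hLo', hXo'⟩)
  have ind : ∀ {X Y : Set (Config E)}, DependsOn (· ∈ X) (within ends VL) →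
      DependsOn (· ∈ Y) (within ends VH) → prob p (X ∩ Y) = prob p X * prob p Y :=
    fun hX hY => prob_inter_eq_mul_of_dependsOn p hdis hX hY
  have hBc : prob p Bᶜ = 1 - prob p B := prob_compl p B
  have hsplit_o : prob p (Lo ∩ A) + prob p (Lo ∩ Aᶜ) = prob p Lo :=
    prob_inter_add_prob_inter_compl p Lo A
  have hsplit_z : prob p (Zb ∩ B) + prob p (Zb ∩ Bᶜ) = prob p Zb :=
    prob_inter_add_prob_inter_compl p Zb B
  have d0 : prob p (A ∩ B)ᶜ = 1 - prob p A * prob p B := by rw [prob_compl, ind dA dB]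
  have e1 : prob p (Zb ∩ (A ∩ B)ᶜ) = prob p Zb - prob p A * prob p (Zb ∩ B) := by
    have := prob_inter_add_prob_inter_compl p Zb (A ∩ B)
    rw [set_h1, ind dA (depI dZb dB)] at this
    linarith
  have e2 : prob p (A ∩ (A ∩ B)ᶜ) = prob p A * (1 - prob p B) := by
    rw [set_h2, ind dA dBc, hBc]
  have e3 : prob p (Zb ∩ A ∩ (A ∩ B)ᶜ) = prob p A * prob p (Zb ∩ Bᶜ) := by
    rw [set_h3, ind dA (depI dZb dBc)]
  have e4 : prob p (Lo ∩ (A ∩ B)ᶜ) = prob p Lo - prob p (Lo ∩ A) * prob p B := by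
    have := prob_inter_add_prob_inter_compl p Lo (A ∩ B)
    rw [set_m5', ind (depI dLo dA) dB] at this
    linarith
  have e5 : prob p (Zb ∩ Lo ∩ (A ∩ B)ᶜ) = prob p Lo * prob p Zb - prob p (Lo ∩ A) * prob p (Zb ∩ B) := by
    have h1 := prob_inter_add_prob_inter_compl p (Zb ∩ Lo) (A ∩ B)
    rw [set_h5, ind (depI dLo dA) (depI dZb dB)] at h1
    have h2 : prob p (Zb ∩ Lo) = prob p Lo * prob p Zb := by
      rw [Set.inter_comm]; exact ind dLo dZb
    linarith
  have e6 : prob p ((Lo ∪ B ∩ Xo) ∩ (A ∩ B)ᶜ) =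
      (prob p Lo - prob p (Lo ∩ A) * prob p B) + prob p (Xo ∩ Aᶜ) * prob p B := by
    rw [set_m5, prob_union_of_disjoint p hdisj1, e4, ind (depI dXo dAc) dB]
  have e7 : prob p (A ∩ (Lo ∪ B ∩ Xo) ∩ (A ∩ B)ᶜ) = prob p (Lo ∩ A) * (1 - prob p B) := by
    rw [set_h7, ind (depI dLo dA) dBc, hBc]
  have e8 : prob p (Zb ∩ A ∩ (Lo ∪ B ∩ Xo) ∩ (A ∩ B)ᶜ) = prob p (Lo ∩ A) * prob p (Zb ∩ Bᶜ) := by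
    rw [set_h8, ind (depI dLo dA) (depI dZb dBc)]
  rw [d0, e1, e2, e3, e5, e6, e7, e8, e4]
  clear d0 e1 e2 e3 e4 e5 e6 e7 e8 hdisj1
  have hHarris_o := prob_mul_prob_le_prob_inter hp (isUpperSet_CW (ends := ends) (W := VL) a₁ o)
    (isUpperSet_CW (ends := ends) (W := VL) a₁ u)
  have hHarris_z := prob_mul_prob_le_prob_inter hp (isUpperSet_CW (ends := ends) (W := VH) a₂ b)
    (isUpperSet_CW (ends := ends) (W := VH) u a₂)
  have hβ0 := prob_nonneg hp B
  have hβ1 := prob_le_one hp B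
  have htu0 := prob_nonneg hp A
  have htu1 := prob_le_one hp A
  have hxo := prob_nonneg hp (Xo ∩ Aᶜ)
  rw [← hsplit_o, ← hsplit_z]
  rw [← hsplit_o] at hHarris_o
  rw [← hsplit_z] at hHarris_z
  clear hsplit_o hsplit_z dA dLo dXo dB dZb dAc dBc hLoXo ind hBc
  generalize prob p B = β at *
  generalize prob p A = tu at *
  generalize prob p (Lo ∩ A) = kou at *
  generalize prob p (Lo ∩ Aᶜ) = mo at *
  generalize prob p (Xo ∩ Aᶜ) = xo at *
  generalize prob p (Zb ∩ B) = zb at *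
  generalize prob p (Zb ∩ Bᶜ) = zc at *
  have hCo : 0 ≤ kou - tu * (kou + mo) := by linarith only [hHarris_o]
  have hCz : 0 ≤ zb - β * (zb + zc) := by linarith only [hHarris_z]
  have key : (1 - tu * β) * ((1 - tu * β) * (kou * zc) - (zb + zc - tu * zb) * (kou * (1 - β))) -
        (kou + mo - kou * β + xo * β) * ((1 - tu * β) * (tu * zc) - (zb + zc - tu * zb) * (tu * (1 - β))) -
        (1 - tu * β) * ((1 - tu * β) * ((kou + mo) * (zb + zc) - kou * zb) -
          (zb + zc - tu * zb) * (kou + mo - kou * β)) =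
      tu * (zb - β * (zb + zc)) * ((1 - β) * (kou - tu * (kou + mo)) + β * (1 - tu) * xo) := by ring
  rw [key]
  apply mul_nonneg (mul_nonneg htu0 hCz)
  exact add_nonneg (mul_nonneg (by linarith only [hβ1]) hCo)
    (mul_nonneg (mul_nonneg hβ0 (by linarith only [htu1])) hxo)


/-- **A cross-cluster covariance factorises across the cut vertex**: for `o ∈ VL`, `b ∈ VH`,
`P(Q) P(H_b L_o Q) − P(H_b Q) P(L_o Q) = −Cov_VL(L_o, L_u) · Cov_VH(Z_b, B)` — the BHK-1.4 covariance
`P(Q)² Cov_Q(H_b, L_o)` is minus the product of the two side Harris covariances. -/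
theorem cov_cross_factor (p : E → R) (ends : E → Sym2 V) (o a₁ a₂ b u : V)
    {VL VH : Set V} (hc : CutSep ends a₁ o a₂ b u VL VH) :
    prob p (connEvent ends a₁ a₂)ᶜ * prob p (connEvent ends a₂ b ∩ connEvent ends a₁ o ∩ (connEvent ends a₁ a₂)ᶜ) -
        prob p (connEvent ends a₂ b ∩ (connEvent ends a₁ a₂)ᶜ) *
          prob p (connEvent ends a₁ o ∩ (connEvent ends a₁ a₂)ᶜ) =
      -((prob p (CW ends VL a₁ o ∩ CW ends VL a₁ u) - prob p (CW ends VL a₁ u) * prob p (CW ends VL a₁ o)) *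
        (prob p (CW ends VH a₂ b ∩ CW ends VH u a₂) - prob p (CW ends VH u a₂) * prob p (CW ends VH a₂ b))) := by
  have hQ : connEvent ends a₁ a₂ = CW ends VL a₁ u ∩ CW ends VH u a₂ :=
    connEvent_eq_cross_LH hc hc.a1L hc.a2H hc.a2u
  have hHb : connEvent ends a₂ b = CW ends VH a₂ b := connEvent_eq_CW_H hc hc.a2H hc.bH
  have hLo : connEvent ends a₁ o = CW ends VL a₁ o := connEvent_eq_CW_L hc hc.a1L hc.oL
  rw [hQ, hHb, hLo]
  set A := CW ends VL a₁ u with hA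
  set B := CW ends VH u a₂ with hB
  set Zb := CW ends VH a₂ b with hZb
  set Lo := CW ends VL a₁ o with hLo'
  have hdis := disjoint_within hc
  have dA : DependsOn (· ∈ A) (within ends VL) := dependsOn_CW a₁ u
  have dLo : DependsOn (· ∈ Lo) (within ends VL) := dependsOn_CW a₁ o
  have dB : DependsOn (· ∈ B) (within ends VH) := dependsOn_CW u a₂
  have dZb : DependsOn (· ∈ Zb) (within ends VH) := dependsOn_CW a₂ b
  have ind : ∀ {X Y : Set (Config E)}, DependsOn (· ∈ X) (within ends VL) →
      DependsOn (· ∈ Y) (within ends VH) → prob p (X ∩ Y) = prob p X * prob p Y :=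
    fun hX hY => prob_inter_eq_mul_of_dependsOn p hdis hX hY
  have d0 : prob p (A ∩ B)ᶜ = 1 - prob p A * prob p B := by rw [prob_compl, ind dA dB]
  have e1 : prob p (Zb ∩ (A ∩ B)ᶜ) = prob p Zb - prob p A * prob p (Zb ∩ B) := by
    have := prob_inter_add_prob_inter_compl p Zb (A ∩ B)
    rw [set_h1, ind dA (depI dZb dB)] at this
    linarith
  have e4 : prob p (Lo ∩ (A ∩ B)ᶜ) = prob p Lo - prob p (Lo ∩ A) * prob p B := by
    have := prob_inter_add_prob_inter_compl p Lo (A ∩ B)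
    rw [set_m5', ind (depI dLo dA) dB] at this
    linarith
  have e5 : prob p (Zb ∩ Lo ∩ (A ∩ B)ᶜ) = prob p Lo * prob p Zb - prob p (Lo ∩ A) * prob p (Zb ∩ B) := by
    have h1 := prob_inter_add_prob_inter_compl p (Zb ∩ Lo) (A ∩ B)
    rw [set_h5, ind (depI dLo dA) (depI dZb dB)] at h1
    have h2 : prob p (Zb ∩ Lo) = prob p Lo * prob p Zb := by
      rw [Set.inter_comm]; exact ind dLo dZb
    linarith
  rw [d0, e1, e4, e5]
  ring

end MainL

end CutMixedPM

end Summit.Ventures.PercRepro2
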